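import Literature.NumberTheory.Automorphic.UnboundedDenominatorsLeveragingProofs
import Literature.NumberTheory.Automorphic.WohlfahrtTheorem

/-!
# The unbounded denominators theorem (Calegari–Dimitrov–Tang) — §4.4: Lemma 4.4.1 (Serre–Berger) from the congruence-kernel sentence, and Theorem 4.3.1 assembled

Fifth sibling of `Literature/NumberTheory/Automorphic/UnboundedDenominators.lean`; sequel of
`UnboundedDenominatorsLeveragingProofs.lean` (display (4.4.9) and Theorem 4.3.1 from Lemma 4.4.4 in
hypothesis form). Sorry-free theorems only; NO definition, NO named fact (D-0026). Source:
F. Calegari, V. Dimitrov, Y. Tang, *The unbounded denominators conjecture*, J. Amer. Math. Soc.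
**38** (2025), 627–702 = arXiv:2109.09040v4, §4.4 (published numbering).

## What is proved

CDT's Lemma 4.4.4 — surjectivity of `(f₁, f₂, π) : Γ(N) ∩ Γ₀(p) → S × S × B` — splits as
(a) Lemma 4.4.1 (Serre, Berger): `(f₁, f₂) : Γ(N) ∩ Γ₀(p) ↠ S × S`, whose proof is Goursat's lemma
+ the amalgam `Γ(N) ⋆ A⁻¹Γ(N)A ≅ Γ̃(N) ≤ SL₂(ℤ[1/p])` + the congruence subgroup property of
`SL₂(ℤ[1/p])` + Wohlfahrt's theorem, and (b) the Borel factor (§4.5 Theorem 4.5.2, §4.6 Lemma 4.6.3,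
"Ihara's lemma, enhanced"). Here:

* `forall_exists_mul_inv_mem_and_diag_conj_of_ker_congruence` — **Lemma 4.4.1 in hypothesis
  form**: everything in its printed proof is carried out (projections onto both factors, Goursat via
  Mathlib's `Subgroup.goursat_surjective`, Wohlfahrt via the tree's
  `Wohlfahrt.Gamma_le_of_isCongruenceSubgroup_of_forall_conj_T_pow_mem`) EXCEPT the one sentence
  invoking the amalgam and the congruence subgroup property, which is the hypothesis `hker`: for a
  finite group `Δ` and `g₁, g₂ : Γ(N) → Δ` with `g₁ x = g₂ (A x A⁻¹)` on `Γ(N) ∩ Γ₀(p)`, `ker g₁`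
  contains some `Γ(M) ∩ Γ(N)`, `M ≠ 0` [Ser80 = Serre, *Trees* II.1.4; Tho89 = Thompson 1989,
  Theorem 3 (Serre's letter); Ber94 = Berger 1994, p. 919; Men67 = Mennicke 1967; Ser70 = Serre 1970].
* `forall_exists_conjGL_of_ker_congruence_of_borel` — (a) + the Borel factor in the form actually
  needed ("`G ∩ A⁻¹GA ∩ Γ(N) ∩ Γ₀(p)` maps ONTO the Borel `B ⊂ SL₂(𝔽_p)` under reduction mod `p`";
  it contains `Tᴺ`, so this is a statement about the diagonal torus — the content of §§4.5–4.6)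
  give the diagonal hypothesis of `Gamma_inf_Gamma0_le_sup_of_forall_exists_conjGL`, i.e. what
  display (4.4.9) and Theorem 4.3.1 consume. (Lemma 4.4.4 ⟺ Lemma 4.4.1 ∧ this torus statement:
  correct a preimage of `(s₁, s₂)` by an element of `ker f₁ ∩ ker f₂ = G ∩ A⁻¹GA ∩ D`.)
* `exists_congruence_modularForm_of_slash_diag_invariant_of_ker_congruence` — **Theorem 4.3.1
  assembled**: under `hker` and the torus statement, a weight-`k` modular form `f` on `G` whose
  `f ∣ₖ A = p^{k-1} f(pτ)` is invariant under `G ∩ Γ(N p)` is congruence-modular.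

So after this file the §4 input of CDT's proof is reduced to two precisely typed classical/printed
statements: the congruence-kernel sentence `hker` (amalgam + CSP for `SL₂(ℤ[1/p])`) and the torus
surjectivity (CDT §§4.5–4.6), plus the field theory of `R_N`, `M_N` (Definition 4.2.1,
Theorem 4.3.2) downstream.

## References

* [CalegariDimitrovTang2025] F. Calegari, V. Dimitrov, Y. Tang, The unbounded denominators
  conjecture, J. Amer. Math. Soc. 38 (2025), 627–702; arXiv:2109.09040. §4.4, Lemma 4.4.1 and its
  proof, Lemma 4.4.4, Remark 4.4.8.
* J. G. Thompson, Hecke operators and noncongruence subgroups, in: Group Theory (Singapore 1987),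
  de Gruyter 1989, 215–224 (including a letter from J.-P. Serre), Theorem 3.
* G. Berger, Hecke operators on noncongruence subgroups, C. R. Acad. Sci. Paris 319 (1994),
  915–919, p. 919.
* J.-P. Serre, Le problème des groupes de congruence pour SL₂, Ann. of Math. 92 (1970), 489–527;
  J. Mennicke, On Ihara's modular group, Invent. Math. 4 (1967), 202–228.
-/

noncomputable section

namespace Literature.NumberTheory.Automorphic

open scoped MatrixGroups ModularForm
open CongruenceSubgroup Matrix.SpecialLinearGroup ModularGroup

variable {G : Subgroup SL(2, ℤ)} {N p : ℕ} {A : GL (Fin 2) ℝ}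

/-! ### Matrix bookkeeping -/

/-- Membership in `Γ(M)` as four divisibilities. [folklore] -/
private lemma mem_Gamma_iff_dvd₀ {M : ℕ} {γ : SL(2, ℤ)} :
    γ ∈ Gamma M ↔ (M : ℤ) ∣ γ 0 0 - 1 ∧ (M : ℤ) ∣ γ 0 1 ∧ (M : ℤ) ∣ γ 1 0 ∧ (M : ℤ) ∣ γ 1 1 - 1 := by
  rw [Gamma_mem]
  have h1 : ∀ x : ℤ, (x : ZMod M) = 1 ↔ (M : ℤ) ∣ x - 1 := fun x ↦ by
    rw [← ZMod.intCast_zmod_eq_zero_iff_dvd, Int.cast_sub, Int.cast_one, sub_eq_zero]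
  simp only [h1, ZMod.intCast_zmod_eq_zero_iff_dvd]

/-- The lower unipotent `[1, 0; m, 1] = S⁻¹ T^{-m} S`. [folklore] -/
private lemma exists_lower_unipotent (m : ℤ) :
    ∃ L : SL(2, ℤ), (L : Matrix (Fin 2) (Fin 2) ℤ) = !![1, 0; m, 1] ∧ L = S⁻¹ * T ^ (-m) * S := by
  refine ⟨S⁻¹ * T ^ (-m) * S, ?_, rfl⟩
  rw [coe_mul, coe_mul, coe_inv, coe_S, coe_T_zpow]
  ext i j
  fin_cases i <;> fin_cases j <;> simp [Matrix.adjugate_fin_two, Matrix.mul_apply, Fin.sum_univ_two]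

/-- With all conjugates of `Tᴺ` in `G`: `T^{N k} ∈ G ∩ Γ(N)`. [folklore] -/
private lemma T_zpow_mem_inf (hT : ∀ g : SL(2, ℤ), g * T ^ N * g⁻¹ ∈ G) (k : ℤ) :
    T ^ ((N : ℤ) * k) ∈ G ⊓ Gamma N := by
  refine Subgroup.mem_inf.mpr ⟨?_, ?_⟩
  · rw [zpow_mul, zpow_natCast]
    exact Subgroup.zpow_mem _ (by simpa using hT 1) k
  · exact ModularGroup_T_pow_mem_Gamma N _ (dvd_mul_right _ _)

/-- With all conjugates of `Tᴺ` in `G`: the lower unipotent `[1, 0; N k, 1] ∈ G ∩ Γ(N)`. [folklore] -/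
private lemma lower_mem_inf (hT : ∀ g : SL(2, ℤ), g * T ^ N * g⁻¹ ∈ G) (k : ℤ) :
    ∃ L : SL(2, ℤ), (L : Matrix (Fin 2) (Fin 2) ℤ) = !![1, 0; (N : ℤ) * k, 1] ∧ L ∈ G ⊓ Gamma N := by
  obtain ⟨L, hL, hLS⟩ := exists_lower_unipotent ((N : ℤ) * k)
  refine ⟨L, hL, Subgroup.mem_inf.mpr ⟨?_, ?_⟩⟩
  · rw [hLS, show -((N : ℤ) * k) = (N : ℤ) * (-k) by ring, zpow_mul, zpow_natCast]
    have h := Subgroup.zpow_mem _ (hT S⁻¹) (-k)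
    rwa [conj_zpow, inv_inv] at h
  · rw [mem_Gamma_iff_dvd₀, hL]
    simp

/-! ### The two projections are onto -/

/-- `p ∤ N` in `ZMod p` form. [folklore] -/
private lemma natCast_ne_zero_of_coprime (hp : p.Prime) (hNp : N.Coprime p) :
    (N : ZMod p) ≠ 0 := by
  rw [Ne, ZMod.natCast_eq_zero_iff]
  intro h
  have := Nat.Coprime.eq_one_of_dvd (Nat.Coprime.symm hNp) h
  exact hp.one_lt.ne' this

/-- In `SL(2)`: if `p ∣ y₀₀` then `p ∤ y₁₀` and `p ∤ y₀₁` (determinant `1`). [folklore] -/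
private lemma apply_ne_zero_of_apply_eq_zero (hp : p.Prime) (y : SL(2, ℤ))
    (h : ((y 0 0 : ℤ) : ZMod p) = 0) :
    ((y 1 0 : ℤ) : ZMod p) ≠ 0 ∧ ((y 0 1 : ℤ) : ZMod p) ≠ 0 := by
  haveI : Fact p.Prime := ⟨hp⟩
  have hdet : ((y 0 0 : ℤ) : ZMod p) * y 1 1 - y 0 1 * y 1 0 = 1 := by
    have := Matrix.det_fin_two (y : Matrix (Fin 2) (Fin 2) ℤ)
    rw [y.det_coe] at this
    exact_mod_cast congr_arg (fun z : ℤ ↦ (z : ZMod p)) this.symm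
  rw [h, zero_mul, zero_sub, neg_eq_iff_eq_neg] at hdet
  constructor
  · intro h0; rw [h0, mul_zero] at hdet; simp at hdet
  · intro h0; rw [h0, zero_mul] at hdet; simp at hdet

/-- Same with the roles of the diagonal entries exchanged: if `p ∣ y₁₁` then `p ∤ y₁₀`, `p ∤ y₀₁`.
[folklore] -/
private lemma apply_ne_zero_of_apply_one_one_eq_zero (hp : p.Prime) (y : SL(2, ℤ))
    (h : ((y 1 1 : ℤ) : ZMod p) = 0) :
    ((y 1 0 : ℤ) : ZMod p) ≠ 0 ∧ ((y 0 1 : ℤ) : ZMod p) ≠ 0 := by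
  haveI : Fact p.Prime := ⟨hp⟩
  have hdet : ((y 0 0 : ℤ) : ZMod p) * y 1 1 - y 0 1 * y 1 0 = 1 := by
    have := Matrix.det_fin_two (y : Matrix (Fin 2) (Fin 2) ℤ)
    rw [y.det_coe] at this
    exact_mod_cast congr_arg (fun z : ℤ ↦ (z : ZMod p)) this.symm
  rw [h, mul_zero, zero_sub, neg_eq_iff_eq_neg] at hdet
  constructor
  · intro h0; rw [h0, mul_zero] at hdet; simp at hdet
  · intro h0; rw [h0, zero_mul] at hdet; simp at hdet

/-- **`f₁` is onto**: for `y ∈ Γ(N)` there is `g ∈ G ∩ Γ(N)` with `g⁻¹ y ∈ Γ₀(p)` — a lower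
unipotent `[1, 0; N k, 1]`, after a preliminary `Tᴺ` if `p ∣ y₀₀`. [folklore] -/
private lemma exists_mem_inf_inv_mul_mem_Gamma0 (hT : ∀ g : SL(2, ℤ), g * T ^ N * g⁻¹ ∈ G)
    (hp : p.Prime) (hNp : N.Coprime p) (y : SL(2, ℤ)) :
    ∃ g ∈ G ⊓ Gamma N, g⁻¹ * y ∈ Gamma0 p := by
  haveI : Fact p.Prime := ⟨hp⟩
  have hN := natCast_ne_zero_of_coprime hp hNp
  -- the case `p ∤ y₀₀`
  have step : ∀ y : SL(2, ℤ), ((y 0 0 : ℤ) : ZMod p) ≠ 0 →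
      ∃ g ∈ G ⊓ Gamma N, g⁻¹ * y ∈ Gamma0 p := by
    intro y ha
    obtain ⟨k, hk⟩ := ZMod.intCast_surjective
      (((y 1 0 : ℤ) : ZMod p) * ((N : ZMod p) * ((y 0 0 : ℤ) : ZMod p))⁻¹)
    obtain ⟨L, hL, hLmem⟩ := lower_mem_inf hT k
    refine ⟨L, hLmem, ?_⟩
    have hLinv : ((L⁻¹ : SL(2, ℤ)) : Matrix (Fin 2) (Fin 2) ℤ) = !![1, 0; -((N : ℤ) * k), 1] := by
      rw [coe_inv, hL, Matrix.adjugate_fin_two_of]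
      simp
    have h10 : ((L⁻¹ * y : SL(2, ℤ)) 1 0 : ℤ) = -((N : ℤ) * k) * y 0 0 + y 1 0 := by
      rw [coe_mul, hLinv]
      simp [Matrix.mul_apply, Fin.sum_univ_two]
    rw [Gamma0_mem, h10]
    push_cast
    rw [hk]
    linear_combination (-((y 1 0 : ℤ) : ZMod p)) * mul_inv_cancel₀ (mul_ne_zero hN ha)
  by_cases ha : ((y 0 0 : ℤ) : ZMod p) ≠ 0
  · exact step y ha
  · rw [not_ne_iff] at ha
    have hc := (apply_ne_zero_of_apply_eq_zero hp y ha).1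
    -- `y' = T⁻ᴺ y` has `y'₀₀ = y₀₀ - N y₁₀ ≢ 0`
    have hTmem := T_zpow_mem_inf hT 1
    rw [mul_one] at hTmem
    have h00 : (((T ^ (N : ℤ))⁻¹ * y : SL(2, ℤ)) 0 0 : ℤ) = y 0 0 - N * y 1 0 := by
      rw [← zpow_neg, coe_mul, coe_T_zpow]
      simp [Matrix.mul_apply, Fin.sum_univ_two]
      ring
    obtain ⟨g, hg, hg'⟩ := step ((T ^ (N : ℤ))⁻¹ * y) (by
      rw [h00]; push_cast; rw [ha, zero_sub, neg_ne_zero]; exact mul_ne_zero hN hc)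
    refine ⟨T ^ (N : ℤ) * g, mul_mem hTmem hg, ?_⟩
    rwa [mul_inv_rev, mul_assoc]

/-- **`f₂` is onto**: for `y ∈ Γ(N)` there is `g ∈ G ∩ Γ(N)` with `p ∣ (g y)₀₁`, i.e.
`g y ∈ Γ⁰(p) = A Γ₀(p) A⁻¹` — an upper unipotent `T^{-Nk}`, after a preliminary `[1, 0; N, 1]` if
`p ∣ y₁₁`. [folklore] -/
private lemma exists_mem_inf_dvd_mul_apply (hT : ∀ g : SL(2, ℤ), g * T ^ N * g⁻¹ ∈ G)
    (hp : p.Prime) (hNp : N.Coprime p) (y : SL(2, ℤ)) :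
    ∃ g ∈ G ⊓ Gamma N, (p : ℤ) ∣ (g * y) 0 1 := by
  haveI : Fact p.Prime := ⟨hp⟩
  have hN := natCast_ne_zero_of_coprime hp hNp
  have step : ∀ y : SL(2, ℤ), ((y 1 1 : ℤ) : ZMod p) ≠ 0 →
      ∃ g ∈ G ⊓ Gamma N, (p : ℤ) ∣ (g * y) 0 1 := by
    intro y hd
    obtain ⟨k, hk⟩ := ZMod.intCast_surjective
      (((y 0 1 : ℤ) : ZMod p) * ((N : ZMod p) * ((y 1 1 : ℤ) : ZMod p))⁻¹)
    refine ⟨T ^ ((N : ℤ) * (-k)), T_zpow_mem_inf hT (-k), ?_⟩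
    have h01 : ((T ^ ((N : ℤ) * (-k)) * y : SL(2, ℤ)) 0 1 : ℤ) = -((N : ℤ) * k) * y 1 1 + y 0 1 := by
      rw [coe_mul, coe_T_zpow]
      simp [Matrix.mul_apply, Fin.sum_univ_two]
      ring
    rw [← ZMod.intCast_zmod_eq_zero_iff_dvd, h01]
    push_cast
    rw [hk]
    linear_combination (-((y 0 1 : ℤ) : ZMod p)) * mul_inv_cancel₀ (mul_ne_zero hN hd)
  by_cases hd : ((y 1 1 : ℤ) : ZMod p) ≠ 0
  · exact step y hd
  · rw [not_ne_iff] at hd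
    have hb := (apply_ne_zero_of_apply_one_one_eq_zero hp y hd).2
    obtain ⟨L, hL, hLmem⟩ := lower_mem_inf hT 1
    have h11 : ((L * y : SL(2, ℤ)) 1 1 : ℤ) = N * y 0 1 + y 1 1 := by
      rw [coe_mul, hL]
      simp [Matrix.mul_apply, Fin.sum_univ_two]
    obtain ⟨g, hg, hg'⟩ := step (L * y) (by
      rw [h11]; push_cast; rw [hd, add_zero]; exact mul_ne_zero hN hb)
    exact ⟨g * L, mul_mem hg hLmem, by rwa [mul_assoc]⟩


/-! ### Conjugation by `A = diag(p, 1)` on `Γ(N) ∩ Γ₀(p)` -/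

/-- The `GL₂(ℝ)` bookkeeping for `A = diag(p, 1)`: `A y = x A` as soon as `y₀₀ = x₀₀`,
`p y₀₁ = x₀₁`, `y₁₀ = p x₁₀`, `y₁₁ = x₁₁` (i.e. `y = A⁻¹ x A`). [folklore] -/
private lemma diag_mul_mapGL_eq₀ {y x : SL(2, ℤ)} {A : GL (Fin 2) ℝ} {p : ℕ}
    (hA : (A : Matrix (Fin 2) (Fin 2) ℝ) = !![(p : ℝ), 0; 0, 1])
    (h00 : y 0 0 = x 0 0) (h01 : (p : ℤ) * y 0 1 = x 0 1) (h10 : y 1 0 = p * x 1 0)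
    (h11 : y 1 1 = x 1 1) :
    A * mapGL ℝ y = mapGL ℝ x * A := by
  have r00 : ((y 0 0 : ℤ) : ℝ) = x 0 0 := by exact_mod_cast h00
  have r01 : (p : ℝ) * y 0 1 = x 0 1 := by exact_mod_cast h01
  have r10 : ((y 1 0 : ℤ) : ℝ) = p * x 1 0 := by exact_mod_cast h10
  have r11 : ((y 1 1 : ℤ) : ℝ) = x 1 1 := by exact_mod_cast h11
  apply Units.ext
  simp only [Units.val_mul, mapGL, MonoidHom.coe_comp, Function.comp_apply, coe_GL_coe_matrix,
    map_apply_coe, RingHom.mapMatrix_apply, hA]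
  ext i j
  fin_cases i <;> fin_cases j <;>
    simp only [Matrix.mul_apply, Fin.sum_univ_two, Matrix.map_apply, Matrix.of_apply,
      Matrix.cons_val', Matrix.cons_val_zero, Matrix.cons_val_one, Matrix.cons_val_fin_one,
      Matrix.empty_val', eq_intCast, Fin.zero_eta, Fin.mk_one, Fin.isValue]
  · linear_combination (p : ℝ) * r00
  · linear_combination r01
  · linear_combination r10
  · linear_combination r11

/-- `A (Γ(N) ∩ Γ₀(p)) A⁻¹ ⊆ Γ(N) ∩ Γ⁰(p)` for `A = diag(p, 1)`, `N`, `p` coprime: for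
`x ∈ Γ(N) ∩ Γ₀(p)` there is `y ∈ Γ(N)` with `p ∣ y₀₁` and `A x = y A` (`y = A x A⁻¹ =
[x₀₀, p x₀₁; x₁₀/p, x₁₁]`). [folklore] -/
private lemma exists_mem_Gamma_diag_conj (hNp : N.Coprime p)
    (hA : (A : Matrix (Fin 2) (Fin 2) ℝ) = !![(p : ℝ), 0; 0, 1]) {x : SL(2, ℤ)}
    (hx : x ∈ Gamma N ⊓ Gamma0 p) :
    ∃ y ∈ Gamma N, (p : ℤ) ∣ y 0 1 ∧ A * mapGL ℝ x = mapGL ℝ y * A := by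
  obtain ⟨h00, h01, h10, h11⟩ := mem_Gamma_iff_dvd₀.mp hx.1
  obtain ⟨c, hc⟩ : (p : ℤ) ∣ x 1 0 := (ZMod.intCast_zmod_eq_zero_iff_dvd _ _).mp hx.2
  have hdet : x 0 0 * x 1 1 - x 0 1 * x 1 0 = 1 := by
    have := Matrix.det_fin_two (x : Matrix (Fin 2) (Fin 2) ℤ)
    rw [x.det_coe] at this
    exact this.symm
  let y : SL(2, ℤ) := ⟨!![x 0 0, p * x 0 1; c, x 1 1], by
    rw [Matrix.det_fin_two_of]; linear_combination hdet + x 0 1 * hc⟩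
  have hcop : IsCoprime (N : ℤ) (p : ℤ) := Nat.isCoprime_iff_coprime.mpr hNp
  refine ⟨y, ?_, ⟨x 0 1, rfl⟩, diag_mul_mapGL_eq₀ (y := x) (x := y) hA rfl rfl hc rfl⟩
  refine mem_Gamma_iff_dvd₀.mpr ⟨?_, ?_, ?_, ?_⟩ <;>
    simp only [y, Matrix.of_apply, Matrix.cons_val', Matrix.cons_val_zero, Matrix.cons_val_one,
      Matrix.cons_val_fin_one, Matrix.empty_val']
  · exact h00
  · exact h01.mul_left _
  · rw [hc] at h10
    exact hcop.dvd_of_dvd_mul_left h10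
  · exact h11

/-- Conversely `A⁻¹ (Γ(N) ∩ Γ⁰(p)) A ⊆ Γ(N) ∩ Γ₀(p)`: for `z ∈ Γ(N)` with `p ∣ z₀₁` there is
`x ∈ Γ(N) ∩ Γ₀(p)` with `A x = z A` (`x = A⁻¹ z A = [z₀₀, z₀₁/p; p z₁₀, z₁₁]`). [folklore] -/
private lemma exists_mem_inf_diag_conj_eq (hNp : N.Coprime p)
    (hA : (A : Matrix (Fin 2) (Fin 2) ℝ) = !![(p : ℝ), 0; 0, 1]) {z : SL(2, ℤ)}
    (hz : z ∈ Gamma N) (hpz : (p : ℤ) ∣ z 0 1) :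
    ∃ x ∈ Gamma N ⊓ Gamma0 p, A * mapGL ℝ x = mapGL ℝ z * A := by
  obtain ⟨h00, h01, h10, h11⟩ := mem_Gamma_iff_dvd₀.mp hz
  obtain ⟨b, hb⟩ := hpz
  have hdet : z 0 0 * z 1 1 - z 0 1 * z 1 0 = 1 := by
    have := Matrix.det_fin_two (z : Matrix (Fin 2) (Fin 2) ℤ)
    rw [z.det_coe] at this
    exact this.symm
  let x : SL(2, ℤ) := ⟨!![z 0 0, b; p * z 1 0, z 1 1], by
    rw [Matrix.det_fin_two_of]; linear_combination hdet + z 1 0 * hb⟩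
  have hcop : IsCoprime (N : ℤ) (p : ℤ) := Nat.isCoprime_iff_coprime.mpr hNp
  refine ⟨x, Subgroup.mem_inf.mpr ⟨?_, ?_⟩, diag_mul_mapGL_eq₀ hA rfl (by simp [x, hb]) rfl rfl⟩
  · refine mem_Gamma_iff_dvd₀.mpr ⟨?_, ?_, ?_, ?_⟩ <;>
      simp only [x, Matrix.of_apply, Matrix.cons_val', Matrix.cons_val_zero, Matrix.cons_val_one,
        Matrix.cons_val_fin_one, Matrix.empty_val']
    · exact h00
    · rw [hb, mul_comm] at h01
      exact hcop.dvd_of_dvd_mul_right h01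
    · exact h10.mul_left _
    · exact h11
  · rw [Gamma0_mem, ZMod.intCast_zmod_eq_zero_iff_dvd]
    simp only [x, Matrix.of_apply, Matrix.cons_val', Matrix.cons_val_zero, Matrix.cons_val_one,
      Matrix.cons_val_fin_one, Matrix.empty_val']
    exact dvd_mul_right _ _


/-! ### Lemma 4.4.1 -/

/-- **CDT Lemma 4.4.1 (Serre, Berger), hypothesis form** [cite: CalegariDimitrovTang2025,
Lemma 4.4.1]. Let `G ≤ SL(2, ℤ)` be normal of finite index and contain every conjugate of `Tᴺ`
("Wohlfahrt level dividing `N`"), `p` a prime not dividing `N`, `A = diag(p, 1)`, and write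
`K = Γ(N)`, `D = Γ(N) ∩ Γ₀(p) = Γ(N) ∩ A⁻¹ Γ(N) A`, `S = K/(G ∩ K)` (`= ⟨E, Γ(N)⟩/G` when
`-1 ∈ G ⊆ ⟨E, Γ(N)⟩`), `f : K → S` the projection, `f₁ = f|_D`, `f₂ = f ∘ (A · A⁻¹) : D → S`.
ASSUME the sentence of CDT's proof that combines the amalgam
`Γ(N) ⋆_D A⁻¹Γ(N)A ≅ Γ̃(N) ≤ SL₂(ℤ[1/p])` [Ser80, Tho89 Theorem 3, Ber94 p. 919] with the
congruence subgroup property of `SL₂(ℤ[1/p])` [Men67, Ser70] — "the map `Φ → Δ` is a congruence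
map, and thus the same is true for the restriction to `⟨E, Γ(N)⟩ ⊂ Φ`" — in the form `hker`: for
every finite group `Δ` and homomorphisms `g₁, g₂ : Γ(N) → Δ` with `g₁ x = g₂ (A x A⁻¹)` for all
`x ∈ D`, the kernel of `g₁` contains `Γ(M) ∩ Γ(N)` for some `M ≠ 0`. THEN
`(f₁, f₂) : D → S × S` is surjective; in element form: for all `y₁, y₂ ∈ Γ(N)` there is
`x ∈ Γ(N) ∩ Γ₀(p)` with `x y₁⁻¹ ∈ G` and `(A x A⁻¹) y₂⁻¹ ∈ G`. Proof as printed: both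
projections of the image `I ≤ S × S` are onto (`f₁`: a lower unipotent of `G ∩ Γ(N)` moves any
`y` into `Γ₀(p)`; `f₂`: an upper one moves it into `Γ⁰(p) = A Γ₀(p) A⁻¹`); Goursat's lemma
(Mathlib `Subgroup.goursat_surjective`) gives `π₁ ∘ f₁ = π₂ ∘ f₂` into `Δ = S/N₁`; `hker` makes
`ker (π₁ ∘ f)` a congruence subgroup containing `G ∩ Γ(N)`, hence all conjugates of `Tᴺ`, hence
`Γ(N)` by Wohlfahrt's theorem (tree: `Wohlfahrt.Gamma_le_of_isCongruenceSubgroup_of_forall_conj_T_pow_mem`);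
so `Δ` is trivial, `S × 1 ⊆ I`, `I = S × S`. -/
theorem forall_exists_mul_inv_mem_and_diag_conj_of_ker_congruence [G.Normal] [G.FiniteIndex]
    (hT : ∀ g : SL(2, ℤ), g * T ^ N * g⁻¹ ∈ G) (hp : p.Prime) (hNp : N.Coprime p)
    (hA : (A : Matrix (Fin 2) (Fin 2) ℝ) = !![(p : ℝ), 0; 0, 1])
    (hker : ∀ (Δ : Type) [Group Δ] [Finite Δ] (g₁ g₂ : Gamma N →* Δ),
      (∀ (x : SL(2, ℤ)) (hx : x ∈ Gamma N), x ∈ Gamma0 p → ∀ (y : SL(2, ℤ)) (hy : y ∈ Gamma N),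
        A * mapGL ℝ x = mapGL ℝ y * A → g₁ ⟨x, hx⟩ = g₂ ⟨y, hy⟩) →
      ∃ M : ℕ, M ≠ 0 ∧ ∀ (x : SL(2, ℤ)) (hx : x ∈ Gamma N), x ∈ Gamma M → g₁ ⟨x, hx⟩ = 1) :
    ∀ y₁ ∈ Gamma N, ∀ y₂ ∈ Gamma N, ∃ x ∈ Gamma N ⊓ Gamma0 p,
      x * y₁⁻¹ ∈ G ∧ ∃ y ∈ Gamma N, y * y₂⁻¹ ∈ G ∧ A * mapGL ℝ x = mapGL ℝ y * A := by
  classical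
  -- the groups `K = Γ(N) ⊇ D = Γ(N) ∩ Γ₀(p)`, `G_K = G ∩ K ⊴ K`, `S = K / G_K`
  set K : Subgroup SL(2, ℤ) := Gamma N with hK
  set D : Subgroup SL(2, ℤ) := Gamma N ⊓ Gamma0 p with hD
  have hDK : D ≤ K := inf_le_left
  let GK : Subgroup K := G.subgroupOf K
  haveI : GK.Normal := Subgroup.normal_subgroupOf
  let f : K →* K ⧸ GK := QuotientGroup.mk' GK
  have hf : Function.Surjective f := QuotientGroup.mk'_surjective GK
  have hfeq : ∀ a b : K, f a = f b ↔ (a : SL(2, ℤ)) * (b : SL(2, ℤ))⁻¹ ∈ G := fun a b ↦ by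
    rw [QuotientGroup.mk'_apply, QuotientGroup.mk'_apply, QuotientGroup.eq_iff_div_mem,
      Subgroup.mem_subgroupOf, div_eq_mul_inv]
    rfl
  -- conjugation by `A` as a homomorphism `c : D →* K`
  have hconj : ∀ x : D, ∃ y : K, (p : ℤ) ∣ (y : SL(2, ℤ)) 0 1 ∧
      A * mapGL ℝ (x : SL(2, ℤ)) = mapGL ℝ (y : SL(2, ℤ)) * A := fun x ↦ by
    obtain ⟨y, hy, hpy, he⟩ := exists_mem_Gamma_diag_conj hNp hA x.2
    exact ⟨⟨y, hy⟩, hpy, he⟩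
  choose cf hcf_dvd hcf using hconj
  have hinj : ∀ y y' : SL(2, ℤ), mapGL ℝ y = mapGL ℝ y' → y = y' := fun y y' h ↦
    mapGL_injective h
  let c : D →* K :=
    { toFun := cf
      map_one' := by
        apply Subtype.ext
        apply hinj
        have h := hcf 1
        rw [OneMemClass.coe_one, map_one, mul_one] at h
        rw [OneMemClass.coe_one, map_one]
        exact mul_right_cancel (h.symm.trans (one_mul A).symm)
      map_mul' := fun a b ↦ by
        apply Subtype.ext
        apply hinj
        have hab := hcf (a * b)
        have ha := hcf a
        have hb := hcf b
        rw [Subgroup.coe_mul, map_mul]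
        rw [Subgroup.coe_mul, map_mul, ← mul_assoc, ha, mul_assoc, hb, ← mul_assoc] at hab
        exact (mul_left_injective A hab).symm ▸ rfl }
  have hc : ∀ x : D, A * mapGL ℝ (x : SL(2, ℤ)) = mapGL ℝ ((c x : K) : SL(2, ℤ)) * A := hcf
  -- the two maps `f₁ = f|D`, `f₂ = f ∘ (A · A⁻¹)` and the image `I` of `(f₁, f₂)`
  let f₁ : D →* K ⧸ GK := f.comp (Subgroup.inclusion hDK)
  let f₂ : D →* K ⧸ GK := f.comp c
  let I : Subgroup ((K ⧸ GK) × (K ⧸ GK)) := (f₁.prod f₂).range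
  have hmemI : ∀ x : D, (f₁ x, f₂ x) ∈ I := fun x ↦ ⟨x, rfl⟩
  -- both projections of `I` are onto
  have hI₁ : Function.Surjective (Prod.fst ∘ I.subtype) := by
    intro s
    obtain ⟨y, rfl⟩ := hf s
    obtain ⟨g, hg, hgy⟩ := exists_mem_inf_inv_mul_mem_Gamma0 hT hp hNp (y : SL(2, ℤ))
    have hxD : g⁻¹ * (y : SL(2, ℤ)) ∈ D :=
      Subgroup.mem_inf.mpr ⟨mul_mem (inv_mem hg.2) y.2, hgy⟩
    refine ⟨⟨(f₁ ⟨_, hxD⟩, f₂ ⟨_, hxD⟩), hmemI _⟩, ?_⟩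
    change f₁ ⟨_, hxD⟩ = f y
    change f ⟨g⁻¹ * (y : SL(2, ℤ)), _⟩ = f y
    rw [hfeq]
    simpa using hg.1
  have hI₂ : Function.Surjective (Prod.snd ∘ I.subtype) := by
    intro s
    obtain ⟨y, rfl⟩ := hf s
    obtain ⟨g, hg, hgy⟩ := exists_mem_inf_dvd_mul_apply hT hp hNp (y : SL(2, ℤ))
    obtain ⟨x, hxD, hx⟩ := exists_mem_inf_diag_conj_eq hNp hA (mul_mem hg.2 y.2) hgy
    refine ⟨⟨(f₁ ⟨x, hxD⟩, f₂ ⟨x, hxD⟩), hmemI _⟩, ?_⟩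
    change f₂ ⟨x, hxD⟩ = f y
    change f (c ⟨x, hxD⟩) = f y
    have hcx : ((c ⟨x, hxD⟩ : K) : SL(2, ℤ)) = g * y := by
      apply hinj
      exact mul_left_injective A ((hc ⟨x, hxD⟩).symm.trans hx)
    rw [hfeq, hcx]
    simpa using hg.1
  -- Goursat
  haveI := Subgroup.normal_goursatFst hI₁
  haveI := Subgroup.normal_goursatSnd hI₂
  obtain ⟨e, he⟩ := Subgroup.goursat_surjective hI₁ hI₂
  -- the quotient `Δ = S / N₁` and the two maps `g₁ = π₁ ∘ f`, `g₂ = e⁻¹ ∘ π₂ ∘ f`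
  let g₁ : K →* (K ⧸ GK) ⧸ I.goursatFst := (QuotientGroup.mk' I.goursatFst).comp f
  let g₂ : K →* (K ⧸ GK) ⧸ I.goursatFst :=
    (e.symm.toMonoidHom.comp (QuotientGroup.mk' I.goursatSnd)).comp f
  have hagree : ∀ (x : SL(2, ℤ)) (hx : x ∈ Gamma N), x ∈ Gamma0 p →
      ∀ (y : SL(2, ℤ)) (hy : y ∈ Gamma N),
      A * mapGL ℝ x = mapGL ℝ y * A → g₁ ⟨x, hx⟩ = g₂ ⟨y, hy⟩ := by
    intro x hx hx0 y hy hxy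
    have hxD : x ∈ D := Subgroup.mem_inf.mpr ⟨hx, hx0⟩
    have hyc : (⟨y, hy⟩ : K) = c ⟨x, hxD⟩ := by
      apply Subtype.ext
      apply hinj
      exact mul_left_injective A (hxy.symm.trans (hc ⟨x, hxD⟩))
    -- `(f₁ x, f₂ x) ∈ I`, so its image lies on the graph of `e`
    have hgr : ((QuotientGroup.mk' I.goursatFst) (f₁ ⟨x, hxD⟩),
        (QuotientGroup.mk' I.goursatSnd) (f₂ ⟨x, hxD⟩)) ∈ e.toMonoidHom.graph := by
      rw [← he]
      exact ⟨⟨_, hmemI ⟨x, hxD⟩⟩, rfl⟩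
    rw [MonoidHom.mem_graph] at hgr
    change (QuotientGroup.mk' I.goursatFst) (f ⟨x, hx⟩) =
      e.symm ((QuotientGroup.mk' I.goursatSnd) (f ⟨y, hy⟩))
    rw [hyc, MulEquiv.eq_symm_apply]
    exact hgr
  -- Serre–Berger: `g₁` has congruence kernel …
  obtain ⟨M, hM, hkerM⟩ := hker _ g₁ g₂ hagree
  -- … containing `G ∩ Γ(N)`, of Wohlfahrt level `N`; so (Wohlfahrt) `g₁ = 1`
  let Kg : Subgroup SL(2, ℤ) := (g₁.ker).map K.subtype
  have hKg : ∀ (x : SL(2, ℤ)) (hx : x ∈ Gamma N), g₁ ⟨x, hx⟩ = 1 → x ∈ Kg := fun x hx h ↦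
    ⟨⟨x, hx⟩, h, rfl⟩
  have hcong : IsCongruenceSubgroup Kg := by
    haveI : NeZero N := ⟨fun h ↦ by
      rw [h, Nat.coprime_zero_left] at hNp
      exact hp.one_lt.ne' hNp⟩
    refine ⟨M * N, mul_ne_zero hM (NeZero.ne N), fun x hx ↦ ?_⟩
    have hxN : x ∈ Gamma N := Wohlfahrt.Gamma_le_Gamma_of_dvd (dvd_mul_left N M) hx
    have hxM : x ∈ Gamma M := Wohlfahrt.Gamma_le_Gamma_of_dvd (dvd_mul_right M N) hx
    exact hKg x hxN (hkerM x hxN hxM)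
  have hTKg : ∀ g : SL(2, ℤ), g * T ^ N * g⁻¹ ∈ Kg := by
    intro g
    have hN' : g * T ^ N * g⁻¹ ∈ Gamma N :=
      (Gamma_normal N).conj_mem _ (by simpa using ModularGroup_T_pow_mem_Gamma N N dvd_rfl) g
    refine hKg _ hN' ?_
    change (QuotientGroup.mk' I.goursatFst) (f ⟨_, hN'⟩) = 1
    have : f ⟨_, hN'⟩ = 1 := by
      rw [← map_one f, hfeq]
      simpa using hT g
    rw [this, map_one]
  have hle : Gamma N ≤ Kg :=
    Wohlfahrt.Gamma_le_of_isCongruenceSubgroup_of_forall_conj_T_pow_mem hcong hTKg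
  have hg₁ : ∀ k : K, g₁ k = 1 := by
    intro k
    obtain ⟨k', hk', hk'eq⟩ := hle k.2
    have hk'' : g₁ k' = 1 := hk'
    have : k' = k := Subtype.ext hk'eq
    rwa [this] at hk''
  -- hence `N₁ = S`, i.e. `S × 1 ⊆ I`, and `I = S × S`
  have hfst : ∀ s : K ⧸ GK, (s, (1 : K ⧸ GK)) ∈ I := by
    intro s
    obtain ⟨k, rfl⟩ := hf s
    rw [← Subgroup.mem_goursatFst, ← QuotientGroup.eq_one_iff]
    exact hg₁ k
  have hI : ∀ s₁ s₂ : K ⧸ GK, (s₁, s₂) ∈ I := by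
    intro s₁ s₂
    obtain ⟨⟨⟨t, t₂⟩, ht⟩, ht₂⟩ := hI₂ s₂
    simp only [Function.comp_apply, Subgroup.coe_subtype] at ht₂
    subst ht₂
    have := mul_mem (hfst (s₁ * t⁻¹)) ht
    simpa using this
  -- unpack
  intro y₁ hy₁ y₂ hy₂
  obtain ⟨x, hx⟩ := hI (f ⟨y₁, hy₁⟩) (f ⟨y₂, hy₂⟩)
  have h1 : f (Subgroup.inclusion hDK x) = f ⟨y₁, hy₁⟩ := congr_arg Prod.fst hx
  have h2 : f (c x) = f ⟨y₂, hy₂⟩ := congr_arg Prod.snd hx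
  rw [hfeq] at h1 h2
  exact ⟨x, x.2, h1, (c x : K), (c x).2, h2, hc x⟩


/-! ### From Lemma 4.4.1 to Lemma 4.4.4 and Theorem 4.3.1: the Borel factor -/

/-- **Lemma 4.4.1 + the torus ⟹ the diagonal case of Lemma 4.4.4** [cite: CalegariDimitrovTang2025,
Lemma 4.4.4]. Under the hypotheses of `forall_exists_mul_inv_mem_and_diag_conj_of_ker_congruence`
and the Borel-factor statement `hborel` — every class of `Γ(N) ∩ Γ₀(p)` modulo `Γ(p)` (i.e. every
element of the Borel `B ⊂ SL₂(𝔽_p)`, `p ∤ N`) is represented by an element of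
`G ∩ A⁻¹GA ∩ Γ(N) ∩ Γ₀(p) = ker f₁ ∩ ker f₂` (CDT §§4.5–4.6) — one gets, for every
`d ∈ Γ(N) ∩ Γ₀(p)`, some `u ∈ Γ(N) ∩ Γ₀(p)` with `u d⁻¹ ∈ G ∩ Γ(p)` and `A u A⁻¹ ∈ G`: take
`x` with `(f₁, f₂) x = (f₁ d, 1)` and correct by `w ∈ ker f₁ ∩ ker f₂` with `w ≡ d x⁻¹ (mod p)`,
`u = w x`. This is the hypothesis of `Gamma_inf_Gamma0_le_sup_of_forall_exists_conjGL`
(display (4.4.9)) and of `exists_congruence_modularForm_of_slash_diag_invariant` (Theorem 4.3.1). -/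
theorem forall_exists_conjGL_of_ker_congruence_of_borel [G.Normal] [G.FiniteIndex]
    (hT : ∀ g : SL(2, ℤ), g * T ^ N * g⁻¹ ∈ G) (hp : p.Prime) (hNp : N.Coprime p)
    (hA : (A : Matrix (Fin 2) (Fin 2) ℝ) = !![(p : ℝ), 0; 0, 1])
    (hker : ∀ (Δ : Type) [Group Δ] [Finite Δ] (g₁ g₂ : Gamma N →* Δ),
      (∀ (x : SL(2, ℤ)) (hx : x ∈ Gamma N), x ∈ Gamma0 p → ∀ (y : SL(2, ℤ)) (hy : y ∈ Gamma N),
        A * mapGL ℝ x = mapGL ℝ y * A → g₁ ⟨x, hx⟩ = g₂ ⟨y, hy⟩) →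
      ∃ M : ℕ, M ≠ 0 ∧ ∀ (x : SL(2, ℤ)) (hx : x ∈ Gamma N), x ∈ Gamma M → g₁ ⟨x, hx⟩ = 1)
    (hborel : ∀ z ∈ Gamma N ⊓ Gamma0 p, ∃ w ∈ Gamma N ⊓ Gamma0 p,
      w ∈ G ∧ w ∈ conjGL G A ∧ w * z⁻¹ ∈ Gamma p) :
    ∀ d ∈ Gamma N ⊓ Gamma0 p, ∃ u ∈ Gamma N ⊓ Gamma0 p,
      u * d⁻¹ ∈ G ∧ u ∈ conjGL G A ∧ u * d⁻¹ ∈ Gamma p := by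
  intro d hd
  obtain ⟨x, hx, hxd, y, -, hy1, hAx⟩ :=
    forall_exists_mul_inv_mem_and_diag_conj_of_ker_congruence hT hp hNp hA hker d hd.1 1 (one_mem _)
  rw [inv_one, mul_one] at hy1
  have hxc : x ∈ conjGL G A :=
    mem_conjGL.mpr ⟨y, hy1, (eq_mul_inv_iff_mul_eq.mpr hAx.symm : mapGL ℝ y = A * mapGL ℝ x * A⁻¹)⟩
  obtain ⟨w, hw, hwG, hwc, hwp⟩ := hborel (d * x⁻¹) (mul_mem hd (inv_mem hx))
  refine ⟨w * x, mul_mem hw hx, ?_, mul_mem hwc hxc, ?_⟩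
  · rw [mul_assoc]
    exact mul_mem hwG hxd
  · simpa only [mul_inv_rev, inv_inv, mul_assoc] using hwp

/-- **CDT Theorem 4.3.1, assembled from §4.4** [cite: CalegariDimitrovTang2025, Theorem 4.3.1 and
Lemma 4.4.1]. Let `G ≤ SL(2, ℤ)` be normal of finite index containing every conjugate of `Tᴺ`, `p`
a prime not dividing `N ≠ 0`, `A = diag(p, 1)`. Assume the congruence-kernel sentence `hker`
(amalgam `SL₂(ℤ[1/p])` + congruence subgroup property, as in
`forall_exists_mul_inv_mem_and_diag_conj_of_ker_congruence`) and the torus statement `hborel`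
(CDT §§4.5–4.6, as in `forall_exists_conjGL_of_ker_congruence_of_borel`). If `f` is a weight-`k`
modular form on `G` such that `f ∣ₖ A = p^{k-1} f(pτ)` is invariant under `G ∩ Γ(N p)`, then `f` is a
modular form on a congruence subgroup. (Everything else — Goursat, the projections, Wohlfahrt,
display (4.4.9), the passage `f(pτ) ↦ f` — is proved in the tree.) -/
theorem exists_congruence_modularForm_of_slash_diag_invariant_of_ker_congruence [G.Normal]
    [G.FiniteIndex] {k : ℤ} (hT : ∀ g : SL(2, ℤ), g * T ^ N * g⁻¹ ∈ G) (hN : N ≠ 0) (hp : p.Prime)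
    (hNp : N.Coprime p) (hA : (A : Matrix (Fin 2) (Fin 2) ℝ) = !![(p : ℝ), 0; 0, 1])
    (hker : ∀ (Δ : Type) [Group Δ] [Finite Δ] (g₁ g₂ : Gamma N →* Δ),
      (∀ (x : SL(2, ℤ)) (hx : x ∈ Gamma N), x ∈ Gamma0 p → ∀ (y : SL(2, ℤ)) (hy : y ∈ Gamma N),
        A * mapGL ℝ x = mapGL ℝ y * A → g₁ ⟨x, hx⟩ = g₂ ⟨y, hy⟩) →
      ∃ M : ℕ, M ≠ 0 ∧ ∀ (x : SL(2, ℤ)) (hx : x ∈ Gamma N), x ∈ Gamma M → g₁ ⟨x, hx⟩ = 1)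
    (hborel : ∀ z ∈ Gamma N ⊓ Gamma0 p, ∃ w ∈ Gamma N ⊓ Gamma0 p,
      w ∈ G ∧ w ∈ conjGL G A ∧ w * z⁻¹ ∈ Gamma p)
    (f : ModularForm (G : Subgroup (GL (Fin 2) ℝ)) k)
    (hinv : ∀ γ ∈ G ⊓ Gamma (N * p), (⇑f ∣[k] A) ∣[k] (mapGL ℝ γ) = ⇑f ∣[k] A) :
    ∃ (Γ' : Subgroup SL(2, ℤ)) (g : ModularForm (Γ' : Subgroup (GL (Fin 2) ℝ)) k),
      IsCongruenceSubgroup Γ' ∧ (g : UpperHalfPlane → ℂ) = f :=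
  exists_congruence_modularForm_of_slash_diag_invariant hN hp.ne_zero hNp hA
    (forall_exists_conjGL_of_ker_congruence_of_borel hT hp hNp hA hker hborel) f hinv

end Literature.NumberTheory.Automorphic

end
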